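import Summits.QuantumFields.YangMills.Theorems.BalabanUVNodesN11SupplierRowsOfContinuous
import Summits.QuantumFields.YangMills.Theorems.BalabanUVNodesN11K1CeilingFreeOfSupplyChain

/-!
# DAG node N11 — ROAD-AGNOSTIC NODE FACES FROM A FAMILY OF N11 TOKENS ON THE STEP WINDOW `hN : ∀ P, Step.InInterval γ P.K (gOfRecord₁₃ θ P) → SupplyChainAt θ P`
# (the currency EVERY supplier road of the tree pays in): N11's DAG node at every run of any world bound to the CoPH datum with `w.γ ≤ γ`, the thirteen-nodes ceiling transfer,
# `B16.Thm1Printed` at the datum, the `h11`-shaped (S1ᵀ) family, the rung-1 ceiling transfer — and the editions on THE CONTINUITY ROAD (this seat's G: `SupplierObligations` +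
# continuous bounded terms; NO `cR`, NO K0 row, NO bg fact, NO run guard)

HEADER — WORK-UNIT METADATA.  Cell `pub-ymgap`, YM-PLAN Track A (HUMAN RULING D-0062 ∕ D-0149 width seats), seat `pub-ymgap-dag-n11-w1` (g4; WIDTH SEAT 1 of 4 on NODE
n11 [B14]), route `BalabanUVNodes` rev 29, KEY item K1⁹ `StabilityBRunRowsAtRecordR13SepCoPHV` = stmt-QuantumFields-27364 (dag-lead KEY MAP v2; helper lane, `--kind proof
--supports 27364 --as helper`, count-neutral; seat payload key K1⁷ 20542 = MIS-KEY fallback).  [III] = [Balaban1988Convergent], [V] = [Balaban1989LargeFieldII], [IV] =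
[Balaban1989LargeFieldI].  Over dag-n11-d g14 `…N11K1CeilingFreeOfSupplyChain` (p609050: `b14_main_leavesP_of_supplyChainAt_of_window`, `nodes_leavesP_withCeiling_of_b14_main`,
`rung1At_withCeiling_of_supplyChainAt`), dag-n11-e `…Sect3SupplyChainObligationsDefs` (`SupplyChainAt`, `thmP245Laws_of_supplyChainAt`), def-T `Node00.Record13CoPH`
(`thm1Printed_datumOfRecord₁₃CoPH_of_tLaw_rOpLeaf`) and `B16RLeafRecord13LiveCoPH` (`rOpLeaf_VOfRecord₁₃CoPH_of_liveSel_of_rstep`), this seat's G `…N11SupplierRowsOfContinuous`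
(p619003: `supplyChainAt_of_gaussCert_of_continuous`).

WHY THIS FILE.  Every N11 supplier road of the tree — the coercive ∕ splice-supply road (dag-n11-w4 g0), the TermRows road (dag-n11-w3), the continuity road (this seat's G), the
SupplierBorel ∕ bg-facts road (this seat's H3; at the cR-lettered member: dag-n11-w5 g2 ∕ dag-n11-w3 g5) — CONCLUDES the same per-run token `SupplyChainAt θ p` from a Step window
`Step.InInterval γ p.K (gOfRecord₁₃ θ p)` (or from nothing).  Every CONSUMER — dag-n11-d g14's node ∕ ceiling ∕ rung faces, def-T's Theorem-1 assembly, dag-n24-c's K1⁹-by-name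
`h11` binder — asks the token (or its (S1ᵀ) consequence) on the DATUM-FLOW window of a world, `((datumOfRecord₁₃CoPH θ h).C P).flow.InInterval w.γ P.K`.  The two windows agree
by `rfl` on the couplings and by `w.γ ≤ γ` on the radius; each road file so far redid that transfer for its own rows (e.g. this seat's `…NodeFacesOfSupplierBorelOfBgFacts`).
THIS FILE types the consumers' faces ONCE against the road-agnostic token FAMILY `hN : ∀ P, Step.InInterval γ P.K (gOfRecord₁₃ θ P) → SupplyChainAt θ P` (§1–§2), so that any
road's ∀-run token theorem instantiates them in one line — and does so for the continuity road (§3), whose node-level faces were not in the tree.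

WHAT THIS FILE PROVES (theorems only, 0 `def`, 0 `sorry`; standard axioms; compositions BY NAME).
§1 `step_inInterval_gOfRecord_of_flow_inInterval_of_le` (the window transfer, `≤` form of H5's `step_inInterval_top_of_flow_inInterval_min`) · ★★ `b14_main_leavesP_all_of_supplyChainAt_family`
   (`∀ P, Dag.B14_main (leavesP w P)` at any `w` with `w.C = (datumOfRecord₁₃CoPH θ h).C`, `w.γ ≤ γ`) · ★★ `nodes_leavesP_withCeiling_of_supplyChainAt_family` · ★★
   `thm1Printed_datumOfRecord₁₃CoPH_of_supplyChainAt_family` (`0 < γ`) · `thm1Printed_datumOfRecord₁₃SepCoPH_of_supplyChainAt_family` · ★★★ `h11Family_of_supplyChainAt_family`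
   (dag-n24-c's `h11` SHAPE at the SepCoPH datum, `γ₁₁ := γ`).
§2 (`N = 2`) ★★ `rung1At_withCeiling_of_supplyChainAt_family` (dag-n11-d g14 §2 re-keyed to the Step-window family, `w.γ ≤ γ`).
§3 THE CONTINUITY ROAD (generic Gaussian-class `θ`; per windowed run [III] §3's supplier `σ P` with `SupplierObligations` and CONTINUITY + the two displayed BOUNDS of its terms —
   G's rows, quantified over the windowed runs): ★★ `supplyChainAt_family_of_gaussCert_of_continuous` (the token family) · ★★★ `b14_main_leavesP_all_of_gaussCert_of_continuous` ·
   ★★★ `thm1Printed_datumOfRecord₁₃SepCoPH_of_gaussCert_of_continuous` · ★★★ `h11Family_of_gaussCert_of_continuous`.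

HONEST FRAMING.  Helper lane of K1⁹; count-neutral KERNEL COMPOSITION of landed theorems plus the `rfl`-level window transfer; the token family, resp. (§3) the certificate,
`SupplierObligations` ([III] §3 ∕ Thm 2 proper — XL, nobody's theorem) and the continuity ∕ bound rows of the supplier's terms are DISPLAYED HYPOTHESES, inhabited at no `θ` here;
nothing of Bałaban asserted.  No v9 stub touched; K1⁹ NOT closed; N11 NOT discharged; counts unmoved (typed 28∕28 · discharged 5∕27 · A 5∕28).  One finite `𝕋⁴_{L^K}` programme at
fixed `ε = L^{−K}`; R4 closes only the conditional finite-𝕋⁴ rung `BalabanLadder.UV` — NOT ℝ⁴, NOT OS, NOT a mass gap, NOT Clay.  No `sorry`, `axiom`, `def`, `instance`, `notation`.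
Sources (SHAPE ∕ bookkeeping only): [III] Thm 1 p.262, Theorem p.245, p.244 L36–38, §3 p.279, (2.6) p.255, (3.16)–(3.21) pp.268–269, (3.23)–(3.25) p.270; [V] Thm 1 + (0.1)
pp.355–356; [IV] (0.3)–(0.4) p.176, p.177 (i)–(ii); [Balaban1987RG1] (0.20) p.256.
-/

noncomputable section

open MeasureTheory TopologicalSpace
open scoped BigOperators ENNReal NNReal Matrix.Norms.L2Operator

namespace Summit.QuantumFields.YangMills.Theorems.BalabanUVNodesN11NodeFacesOfSupplyChainTokens

open Literature.MathematicalPhysics.QuantumFieldTheory.Balaban1983to89 T4Continuum T4NestedCovariance Node00 Node00.Tk DagBinding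
open B15DeterminingSets B8Eq17ClassAkV1 B14.Eq218Concrete B10Eq42TorusConstraint Step
open Literature.MathematicalPhysics.QuantumFieldTheory.Balaban1983to89.B16RLeafRecord13LiveCoPH (rOpLeaf_VOfRecord₁₃CoPH_of_liveSel_of_rstep)
open Summit.QuantumFields.YangMills.Theorems.StabilityBAtRecordR13SepCoPH.Negative.SignBoxAtEveryWitnessFalse (withCeiling Rung1At)
open BalabanUVNodesN11HistoryPinnedResidualDefs BalabanUVNodesN11RePinnedParamDefs
open BalabanUVNodesN11Sect3SupplyChainDefs
open BalabanUVNodesN11Sect3SupplyChainObligationsDefs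
open BalabanUVNodesN11SupplierRowsOfContinuous (supplyChainAt_of_gaussCert_of_continuous)
open BalabanUVNodesN11K1CeilingFreeOfSupplyChain (b14_main_leavesP_of_supplyChainAt_of_window nodes_leavesP_withCeiling_of_b14_main rung1At_withCeiling_of_supplyChainAt)

variable {F : T4Family} {N : ℕ} [NeZero N]

/-! ## §1  The road-agnostic sockets: node faces from a family of tokens on the Step window -/

section Sockets

variable (θ : Stage13HParams F N)

/-- **THE WINDOW TRANSFER** (`≤` form of H5's `step_inInterval_top_of_flow_inInterval_min`): the couplings of the CoPH datum of `θ` along a run `P` ARE the record's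
`gOfRecord₁₃ θ P` (`rfl`), so a datum-flow window `]0, γ′]` with `γ′ ≤ γ` is a Step window `]0, γ]` of the record's couplings. [cite: Balaban1987RG1, (0.20) p.256; Balaban1988Convergent, p.244 (bookkeeping)] -/
theorem step_inInterval_gOfRecord_of_flow_inInterval_of_le (h : θ.Provisos₁₃CoPH F N) {γ' γ : ℝ} (hle : γ' ≤ γ) {P : B12.RunParams}
    (hP : ((datumOfRecord₁₃CoPH F N θ h).C P).flow.InInterval γ' P.K) : Step.InInterval γ P.K (gOfRecord₁₃ F N θ.toStage13Params P) :=
  fun j hj => ⟨(hP j hj).1, (hP j hj).2.trans hle⟩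

/-- **★★ N11's DAG NODE AT EVERY RUN — `∀ P, Dag.B14_main (leavesP w P)` — FROM A FAMILY OF TOKENS ON THE STEP WINDOW `]0, γ]`**, at ANY world `w` bound to the CoPH datum of
`θ` (`w.C = (datumOfRecord₁₃CoPH θ h).C`) with `w.γ ≤ γ`, on the live-selector line (core provisos, selector clause, admissibility, `0 ≤ κ ∕ E₀ ∕ B₀`, `1 ≤ M`): dag-n11-d's
window-threaded per-run face `b14_main_leavesP_of_supplyChainAt_of_window` with the node's own `smallCouplings` window transferred (§1).  ROAD-AGNOSTIC: `hN` is what every supplier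
road of the tree concludes. [cite: Balaban1988Convergent, Thm 1 p.262, Theorem p.245, p.244 L36–38, §3 p.279; Balaban1989LargeFieldII, Introduction pp.355–356; Balaban1989LargeFieldI, (0.3)–(0.4) p.176, p.177 (i)–(ii)] -/
theorem b14_main_leavesP_all_of_supplyChainAt_family (h : θ.Provisos₁₃CoPH F N)
    (hsel : θ.ppSel = ppSelLiveOfRecord F N θ.ν θ.τ9 (EOfRecord₁₃ F N θ.toStage13Params) (wOfRecord₉ F N θ.toStage9Params))
    (hθ : θ.Admissible F N) (hκ : 0 ≤ θ.s2.lf.κ) (hE₀ : 0 ≤ θ.s2.lf.E₀) (hB₀ : 0 ≤ θ.s2.lf.B₀) (hM : 1 ≤ θ.τ9.M) {γ : ℝ}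
    (hN : ∀ P : B12.RunParams, Step.InInterval γ P.K (gOfRecord₁₃ F N θ.toStage13Params P) → SupplyChainAt θ P)
    (w : WorldP) (hC : w.C = (datumOfRecord₁₃CoPH F N θ h).C) (hγw : w.γ ≤ γ) : ∀ P : B12.RunParams, Dag.B14_main (leavesP w P) := fun P =>
  b14_main_leavesP_of_supplyChainAt_of_window h hsel hθ hκ hE₀ hB₀ hM w hC fun hw =>
    hN P (step_inInterval_gOfRecord_of_flow_inInterval_of_le θ h hγw hw)

/-- **★★ THE THIRTEEN DAG NODES PASS TO EVERY CEILING, FROM A FAMILY OF TOKENS ON THE STEP WINDOW** — nodes at `w` (bound to the CoPH datum, `w.γ ≤ γ`) ⇒ nodes at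
`withCeiling w c` for EVERY real `c`: dag-n11-d g14 §1 (`nodes_leavesP_withCeiling_of_b14_main`; `withCeiling` keeps `C` and `γ`, `rfl`) over the node family above.
[cite: Balaban1989LargeFieldII, Introduction pp.355–356 (the citation DAG); Balaban1988Convergent, Thm 1 p.262, (2.6) p.255 (bookkeeping)] -/
theorem nodes_leavesP_withCeiling_of_supplyChainAt_family (h : θ.Provisos₁₃CoPH F N)
    (hsel : θ.ppSel = ppSelLiveOfRecord F N θ.ν θ.τ9 (EOfRecord₁₃ F N θ.toStage13Params) (wOfRecord₉ F N θ.toStage9Params))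
    (hθ : θ.Admissible F N) (hκ : 0 ≤ θ.s2.lf.κ) (hE₀ : 0 ≤ θ.s2.lf.E₀) (hB₀ : 0 ≤ θ.s2.lf.B₀) (hM : 1 ≤ θ.τ9.M) {γ : ℝ}
    (hN : ∀ P : B12.RunParams, Step.InInterval γ P.K (gOfRecord₁₃ F N θ.toStage13Params P) → SupplyChainAt θ P)
    (w : WorldP) (hC : w.C = (datumOfRecord₁₃CoPH F N θ h).C) (hγw : w.γ ≤ γ) (hn : ∀ P : B12.RunParams, Nodes (leavesP w P)) (c : ℝ) :
    ∀ P : B12.RunParams, Nodes (leavesP (withCeiling w c) P) := fun P =>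
  nodes_leavesP_withCeiling_of_b14_main w c P (hn P) (b14_main_leavesP_all_of_supplyChainAt_family θ h hsel hθ hκ hE₀ hB₀ hM hN (withCeiling w c) hC hγw P)

/-- **★★ N11's PRINTED FACE `B16.Thm1Printed (datumOfRecord₁₃CoPH F N θ h).C` FROM A FAMILY OF TOKENS ON THE STEP WINDOW `]0, γ]`, `0 < γ`**, on the live-selector line:
def-T's `thm1Printed_datumOfRecord₁₃CoPH_of_tLaw_rOpLeaf` with the (S1ᵀ) slot by dag-n11-e's `thmP245Laws_of_supplyChainAt` on `hN P` (window transferred, §1) and the 𝐑-leaf on the live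
line (`rOpLeaf_VOfRecord₁₃CoPH_of_liveSel_of_rstep`).  The window printed is `]0, γ]` itself. [cite: Balaban1988Convergent, Thm 1 p.262, Theorem p.245, p.244 L36–38, §3 p.279, (3.16) p.268; Balaban1989LargeFieldII, Thm 1 p.355; Balaban1989LargeFieldI, (0.3)–(0.4) p.176, p.177 (i)–(ii)] -/
theorem thm1Printed_datumOfRecord₁₃CoPH_of_supplyChainAt_family (h : θ.Provisos₁₃CoPH F N)
    (hsel : θ.ppSel = ppSelLiveOfRecord F N θ.ν θ.τ9 (EOfRecord₁₃ F N θ.toStage13Params) (wOfRecord₉ F N θ.toStage9Params))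
    (hθ : θ.Admissible F N) (hκ : 0 ≤ θ.s2.lf.κ) (hE₀ : 0 ≤ θ.s2.lf.E₀) (hB₀ : 0 ≤ θ.s2.lf.B₀) (hM : 1 ≤ θ.τ9.M) {γ : ℝ} (hγ : 0 < γ)
    (hN : ∀ P : B12.RunParams, Step.InInterval γ P.K (gOfRecord₁₃ F N θ.toStage13Params P) → SupplyChainAt θ P) :
    B16.Thm1Printed (datumOfRecord₁₃CoPH F N θ h).C :=
  thm1Printed_datumOfRecord₁₃CoPH_of_tLaw_rOpLeaf F N θ h hγ
    (fun P hP => thmP245Laws_of_supplyChainAt h hsel hθ hκ hE₀ hB₀ hM (hN P (step_inInterval_gOfRecord_of_flow_inInterval_of_le θ h le_rfl hP)))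
    (fun P _ => rOpLeaf_VOfRecord₁₃CoPH_of_liveSel_of_rstep F N θ P (fun q j _ hj => h.rstep q j hj) hθ hκ hE₀ hB₀ hsel)

/-- **`B16.Thm1Printed` AT THE SEPARATED-RANGE DATUM `datumOfRecord₁₃SepCoPH F N θ h`** (the K1 items' key; `datumOfRecord₁₃SepCoPH_eq_coPH`, `rfl`) from a family of tokens on
the Step window. [cite: Balaban1988Convergent, Thm 1 p.262, Theorem p.245, p.244 L36–38; Balaban1989LargeFieldII, Thm 1 p.355] -/
theorem thm1Printed_datumOfRecord₁₃SepCoPH_of_supplyChainAt_family (h : θ.Provisos₁₃SepCoPH F N)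
    (hsel : θ.ppSel = ppSelLiveOfRecord F N θ.ν θ.τ9 (EOfRecord₁₃ F N θ.toStage13Params) (wOfRecord₉ F N θ.toStage9Params))
    (hθ : θ.Admissible F N) (hκ : 0 ≤ θ.s2.lf.κ) (hE₀ : 0 ≤ θ.s2.lf.E₀) (hB₀ : 0 ≤ θ.s2.lf.B₀) (hM : 1 ≤ θ.τ9.M) {γ : ℝ} (hγ : 0 < γ)
    (hN : ∀ P : B12.RunParams, Step.InInterval γ P.K (gOfRecord₁₃ F N θ.toStage13Params P) → SupplyChainAt θ P) :
    B16.Thm1Printed (datumOfRecord₁₃SepCoPH F N θ h).C :=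
  thm1Printed_datumOfRecord₁₃CoPH_of_supplyChainAt_family θ h.toCore hsel hθ hκ hE₀ hB₀ hM hγ hN

/-- **★★★ N11's CHILD FAMILY IN THE `h11` SHAPE OF THE K1⁹-BY-NAME ROAD (dag-n24-c `…K1R9ByName…`, binder `h11` VERBATIM up to the choice of `θ`) FROM A FAMILY OF TOKENS ON THE
STEP WINDOW `]0, γ]`, `0 < γ`**: for every `(βup, β₀)`, with `γ₁₁ := γ`, at EVERY world `w` bound to the SepCoPH datum of `θ` with `w.βup = βup`, `w.β₀ = β₀`, `w.γ ≤ γ₁₁`, for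
EVERY run, under the node's own leaf antecedents, the (S1ᵀ) slot `∀ k < K, SLaw₁₃CoPH θ P k → TLaw₁₃CoPH θ P k` — of the antecedents ONLY `smallCouplings` is read (it is the window
of the record's couplings, transferred by §1); `βup ∕ β₀ ∕ b7…b11 ∕ smallFieldInductive ∕ flowControl` UNREAD.  ROAD-AGNOSTIC socket for the K1 road's N11 binder.
[cite: Balaban1988Convergent, Theorem p.245, Thm 1 p.262, remark p.262, p.244 L36–38, §3 p.279, (2.6) p.255; Balaban1989LargeFieldII, Thm 1 + (0.1) pp.355–356; Balaban1989LargeFieldI, (0.3)–(0.4) p.176, p.177 (i)–(ii)] -/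
theorem h11Family_of_supplyChainAt_family (h : θ.Provisos₁₃SepCoPH F N)
    (hsel : θ.ppSel = ppSelLiveOfRecord F N θ.ν θ.τ9 (EOfRecord₁₃ F N θ.toStage13Params) (wOfRecord₉ F N θ.toStage9Params))
    (hθ : θ.Admissible F N) (hκ : 0 ≤ θ.s2.lf.κ) (hE₀ : 0 ≤ θ.s2.lf.E₀) (hB₀ : 0 ≤ θ.s2.lf.B₀) (hM : 1 ≤ θ.τ9.M) {γ : ℝ} (hγ : 0 < γ)
    (hN : ∀ P : B12.RunParams, Step.InInterval γ P.K (gOfRecord₁₃ F N θ.toStage13Params P) → SupplyChainAt θ P) :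
    ∀ βup β₀ : ℝ, ∃ γ₁₁ : ℝ, 0 < γ₁₁ ∧ ∀ w : WorldP, w.C = (datumOfRecord₁₃SepCoPH F N θ h).C → w.βup = βup → w.β₀ = β₀ → w.γ ≤ γ₁₁ →
      ∀ P : B12.RunParams, (leavesP w P).b7 → (leavesP w P).b8 → (leavesP w P).b9 → (leavesP w P).b10 → (leavesP w P).b11 →
      (leavesP w P).smallCouplings → (leavesP w P).smallFieldInductive → (leavesP w P).flowControl →
        ∀ k, k < P.K → SLaw₁₃CoPH F N θ P k → TLaw₁₃CoPH F N θ P k := fun _ _ =>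
  ⟨γ, hγ, fun w hC _ _ hγw P _ _ _ _ _ hsc _ _ =>
    have hsc' : ((datumOfRecord₁₃SepCoPH F N θ h).C P).flow.InInterval w.γ P.K := by
      have h₀ : (w.C P).flow.InInterval w.γ P.K := hsc
      rwa [hC] at h₀
    thmP245Laws_of_supplyChainAt h.toCore hsel hθ hκ hE₀ hB₀ hM (hN P (step_inInterval_gOfRecord_of_flow_inInterval_of_le θ h.toCore hγw hsc'))⟩

end Sockets

/-! ## §2  `N = 2`: the rung-1 datum passes to every ceiling, from a family of tokens on the Step window -/

section Rung

variable {θ : Stage13HParams F 2} {h : θ.Provisos₁₃SepCoPH F 2} {w : WorldP}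

variable (F) in
/-- **★★ THE RUNG-1 DATUM AT EVERY CEILING FROM A FAMILY OF TOKENS ON THE STEP WINDOW** — dag-n11-d g14 §2 `rung1At_withCeiling_of_supplyChainAt` (p602267's `Rung1At F θ h w` ⇒
`Rung1At F θ h (withCeiling w c)` for every `c`) with its datum-flow-window chain binder served by `hN` on `]0, γ]`, `w.γ ≤ γ` (§1's transfer).
[cite: Balaban1989LargeFieldII, Thm 1 + (0.1) pp.355–356; Balaban1988Convergent, Thm 1 p.262, (2.6) p.255 (bookkeeping)] -/
theorem rung1At_withCeiling_of_supplyChainAt_family (hr : Rung1At F θ h w)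
    (hsel : θ.ppSel = ppSelLiveOfRecord F 2 θ.ν θ.τ9 (EOfRecord₁₃ F 2 θ.toStage13Params) (wOfRecord₉ F 2 θ.toStage9Params))
    (hκ : 0 ≤ θ.s2.lf.κ) (hE₀ : 0 ≤ θ.s2.lf.E₀) (hB₀ : 0 ≤ θ.s2.lf.B₀) (hM : 1 ≤ θ.τ9.M) {γ : ℝ}
    (hN : ∀ P : B12.RunParams, Step.InInterval γ P.K (gOfRecord₁₃ F 2 θ.toStage13Params P) → SupplyChainAt θ P) (hγw : w.γ ≤ γ) (c : ℝ) :
    Rung1At F θ h (withCeiling w c) :=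
  rung1At_withCeiling_of_supplyChainAt F hr hsel hκ hE₀ hB₀ hM (fun P hP => hN P (step_inInterval_gOfRecord_of_flow_inInterval_of_le θ h.toCore hγw hP)) c

end Rung

/-! ## §3  THE CONTINUITY ROAD: the token family, N11's node, `B16.Thm1Printed` and the `h11` family from `SupplierObligations` + continuous bounded terms -/

section Continuous

variable (θ : Stage13HParams F N)

/-- **★★ THE TOKEN FAMILY ON THE STEP WINDOW `]0, γ]` ON THE CONTINUITY ROAD** — per windowed run this seat's G ★★★ `supplyChainAt_of_gaussCert_of_continuous` (p619003): at any `θ` of the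
Gaussian-certificate class (`hζ`, `hq`), core provisos, `1 ≤ M`, and per windowed run [III] §3's supplier `σ P` with `SupplierObligations` whose chain terms `𝐄 ∕ 𝐑 ∕ 𝐁` are CONTINUOUS
in the configuration (resp. in (configuration, fluctuation)) with the two displayed real-part BOUNDS (G §2: the 𝐑-bound is derived by compactness of `SU(N)^{bonds}`, measurability from
continuity).  NO `cR`, NO K0 row, NO bg fact, NO `PartCompat₁₃`. [cite: Balaban1988Convergent, Thm 1 p.262, Theorem p.245, §3 p.279, (3.23)–(3.25) p.270, (3.16)–(3.21) pp.268–269, (2.23)–(2.27) pp.258–259] -/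
theorem supplyChainAt_family_of_gaussCert_of_continuous
    (hζ : ∀ (p : B12.RunParams) (n : ℕ) (Ω Λ : ℕ → Set (Site (F.P p.K) 0)), (θ.Zh p n Ω Λ).ζ0 = (ZhPinOfRecord₁₃ θ.toStage13Params p Ω Λ).ζ0)
    (hq : ∀ (p : B12.RunParams) (n : ℕ) (Ω Λ : ℕ → Set (Site (F.P p.K) 0)) (j : ℕ) (Λ' : Set (Site (F.P p.K) 0)) (ω : MultiCfg (F.P p.K) (SU N) (FluctV N)),
      (θ.Zh p n Ω Λ).quad j Λ' ω = ∑ b ∈ (Set.toFinite (bondsIn j (Λ'ᶜ ∩ Ω (j + 1)))).toFinset, ‖(ω j).2 b‖ ^ 2)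
    (h : θ.Provisos₁₃CoPH F N) (hM : 1 ≤ θ.τ9.M) {γ : ℝ} (σ : (P : B12.RunParams) → Sect3Supplier θ P)
    (hσ : ∀ P : B12.RunParams, Step.InInterval γ P.K (gOfRecord₁₃ F N θ.toStage13Params P) → SupplierObligations θ P (σ P))
    (hE : ∀ P : B12.RunParams, Step.InInterval γ P.K (gOfRecord₁₃ F N θ.toStage13Params P) →
      ∀ (k : ℕ) (s : SeqOfRecord F θ.ν θ.τ9.M (gOfRecord₁₃ F N θ.toStage13Params P) P.K (k + 1)) (j : ℕ), 1 ≤ j →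
      ∀ (X : (Sect2.domSys (F.P P.K) θ.τ9.M j).Dom) (z : Site (F.P P.K) j) (g' : ℝ),
      Continuous (fun U : GaugeField (F.P P.K) 0 (SU N) =>
        ((σ P k (chainWitness θ P (σ P) k).1 (chainWitness θ P (σ P) k).2).1 s).E j X z g' (Sect2.ofBackgroundC (settingOfRecord₁₃ F N θ.toStage13Params P).ι U)))
    (hCE : ∀ P : B12.RunParams, Step.InInterval γ P.K (gOfRecord₁₃ F N θ.toStage13Params P) →
      ∀ (k : ℕ) (s : SeqOfRecord F θ.ν θ.τ9.M (gOfRecord₁₃ F N θ.toStage13Params P) P.K (k + 1)) (j : ℕ), 1 ≤ j → ∃ CE : ℝ,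
      ∀ (X : (Sect2.domSys (F.P P.K) θ.τ9.M j).Dom) (z : Site (F.P P.K) j) (g' : ℝ) (U : GaugeField (F.P P.K) 0 (SU N)),
      |(((σ P k (chainWitness θ P (σ P) k).1 (chainWitness θ P (σ P) k).2).1 s).E j X z g' (Sect2.ofBackgroundC (settingOfRecord₁₃ F N θ.toStage13Params P).ι U)).re| ≤ CE)
    (hR : ∀ P : B12.RunParams, Step.InInterval γ P.K (gOfRecord₁₃ F N θ.toStage13Params P) →
      ∀ (k : ℕ) (s : SeqOfRecord F θ.ν θ.τ9.M (gOfRecord₁₃ F N θ.toStage13Params P) P.K (k + 1)) (j : ℕ), 1 ≤ j → ∀ X : (Sect2.domSys (F.P P.K) θ.τ9.M j).Dom,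
      Continuous (fun U : GaugeField (F.P P.K) 0 (SU N) =>
        ((σ P k (chainWitness θ P (σ P) k).1 (chainWitness θ P (σ P) k).2).1 s).R j X (Sect2.ofBackgroundC (settingOfRecord₁₃ F N θ.toStage13Params P).ι U)))
    (hB : ∀ P : B12.RunParams, Step.InInterval γ P.K (gOfRecord₁₃ F N θ.toStage13Params P) →
      ∀ (k : ℕ) (s : SeqOfRecord F θ.ν θ.τ9.M (gOfRecord₁₃ F N θ.toStage13Params P) P.K (k + 1)) (S' : ℕ → Set (Site (F.P P.K) 0)) (j : ℕ)
        (X : (Sect2.domSys (F.P P.K) θ.τ9.M j).Dom),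
      Continuous (fun q : GaugeField (F.P P.K) 0 (SU N) × MSFluct (F.P P.K) (FluctV N) =>
        ((σ P k (chainWitness θ P (σ P) k).1 (chainWitness θ P (σ P) k).2).1 s).B j X (Sect2.ofBackgroundC (settingOfRecord₁₃ F N θ.toStage13Params P).ι q.1) (S', q.2)))
    (hCB : ∀ P : B12.RunParams, Step.InInterval γ P.K (gOfRecord₁₃ F N θ.toStage13Params P) →
      ∀ (k : ℕ) (s : SeqOfRecord F θ.ν θ.τ9.M (gOfRecord₁₃ F N θ.toStage13Params P) P.K (k + 1)) (j : ℕ), 1 ≤ j → ∃ CB : ℝ,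
      ∀ (X : (Sect2.domSys (F.P P.K) θ.τ9.M j).Dom) (U : GaugeField (F.P P.K) 0 (SU N)) (a : Tk.SFluct (F.P P.K) (FluctV N)),
      |(((σ P k (chainWitness θ P (σ P) k).1 (chainWitness θ P (σ P) k).2).1 s).B j X (Sect2.ofBackgroundC (settingOfRecord₁₃ F N θ.toStage13Params P).ι U) a).re| ≤ CB) :
    ∀ P : B12.RunParams, Step.InInterval γ P.K (gOfRecord₁₃ F N θ.toStage13Params P) → SupplyChainAt θ P := fun P hw =>
  supplyChainAt_of_gaussCert_of_continuous hζ hq h hM (σ P) (hσ P hw) (hE P hw) (hCE P hw) (hR P hw) (hB P hw) (hCB P hw)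

/-- **★★★ N11's DAG NODE AT EVERY RUN ON THE CONTINUITY ROAD — `∀ P, Dag.B14_main (leavesP w P)`** at ANY world `w` bound to the CoPH datum of a Gaussian-class `θ` with `w.γ ≤ γ`,
on the live-selector line (admissibility, `0 ≤ κ ∕ E₀ ∕ B₀`; `1 ≤ M`), from — per windowed run — [III] §3's supplier with `SupplierObligations` and continuous bounded terms (§3's
token family through §1's socket).  NO `cR`, NO K0 row, NO bg fact, NO run guard, NO `w.γ ≤ θ.γ`. [cite: Balaban1988Convergent, Thm 1 p.262, Theorem p.245, p.244 L36–38, §3 p.279, (3.23)–(3.25) p.270; Balaban1989LargeFieldII, Introduction pp.355–356; Balaban1989LargeFieldI, (0.3)–(0.4) p.176, p.177 (i)–(ii)] -/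
theorem b14_main_leavesP_all_of_gaussCert_of_continuous
    (hζ : ∀ (p : B12.RunParams) (n : ℕ) (Ω Λ : ℕ → Set (Site (F.P p.K) 0)), (θ.Zh p n Ω Λ).ζ0 = (ZhPinOfRecord₁₃ θ.toStage13Params p Ω Λ).ζ0)
    (hq : ∀ (p : B12.RunParams) (n : ℕ) (Ω Λ : ℕ → Set (Site (F.P p.K) 0)) (j : ℕ) (Λ' : Set (Site (F.P p.K) 0)) (ω : MultiCfg (F.P p.K) (SU N) (FluctV N)),
      (θ.Zh p n Ω Λ).quad j Λ' ω = ∑ b ∈ (Set.toFinite (bondsIn j (Λ'ᶜ ∩ Ω (j + 1)))).toFinset, ‖(ω j).2 b‖ ^ 2)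
    (h : θ.Provisos₁₃CoPH F N) (hsel : θ.ppSel = ppSelLiveOfRecord F N θ.ν θ.τ9 (EOfRecord₁₃ F N θ.toStage13Params) (wOfRecord₉ F N θ.toStage9Params))
    (hθ : θ.Admissible F N) (hκ : 0 ≤ θ.s2.lf.κ) (hE₀ : 0 ≤ θ.s2.lf.E₀) (hB₀ : 0 ≤ θ.s2.lf.B₀) (hM : 1 ≤ θ.τ9.M) {γ : ℝ} (σ : (P : B12.RunParams) → Sect3Supplier θ P)
    (hσ : ∀ P : B12.RunParams, Step.InInterval γ P.K (gOfRecord₁₃ F N θ.toStage13Params P) → SupplierObligations θ P (σ P))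
    (hE : ∀ P : B12.RunParams, Step.InInterval γ P.K (gOfRecord₁₃ F N θ.toStage13Params P) →
      ∀ (k : ℕ) (s : SeqOfRecord F θ.ν θ.τ9.M (gOfRecord₁₃ F N θ.toStage13Params P) P.K (k + 1)) (j : ℕ), 1 ≤ j →
      ∀ (X : (Sect2.domSys (F.P P.K) θ.τ9.M j).Dom) (z : Site (F.P P.K) j) (g' : ℝ),
      Continuous (fun U : GaugeField (F.P P.K) 0 (SU N) =>
        ((σ P k (chainWitness θ P (σ P) k).1 (chainWitness θ P (σ P) k).2).1 s).E j X z g' (Sect2.ofBackgroundC (settingOfRecord₁₃ F N θ.toStage13Params P).ι U)))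
    (hCE : ∀ P : B12.RunParams, Step.InInterval γ P.K (gOfRecord₁₃ F N θ.toStage13Params P) →
      ∀ (k : ℕ) (s : SeqOfRecord F θ.ν θ.τ9.M (gOfRecord₁₃ F N θ.toStage13Params P) P.K (k + 1)) (j : ℕ), 1 ≤ j → ∃ CE : ℝ,
      ∀ (X : (Sect2.domSys (F.P P.K) θ.τ9.M j).Dom) (z : Site (F.P P.K) j) (g' : ℝ) (U : GaugeField (F.P P.K) 0 (SU N)),
      |(((σ P k (chainWitness θ P (σ P) k).1 (chainWitness θ P (σ P) k).2).1 s).E j X z g' (Sect2.ofBackgroundC (settingOfRecord₁₃ F N θ.toStage13Params P).ι U)).re| ≤ CE)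
    (hR : ∀ P : B12.RunParams, Step.InInterval γ P.K (gOfRecord₁₃ F N θ.toStage13Params P) →
      ∀ (k : ℕ) (s : SeqOfRecord F θ.ν θ.τ9.M (gOfRecord₁₃ F N θ.toStage13Params P) P.K (k + 1)) (j : ℕ), 1 ≤ j → ∀ X : (Sect2.domSys (F.P P.K) θ.τ9.M j).Dom,
      Continuous (fun U : GaugeField (F.P P.K) 0 (SU N) =>
        ((σ P k (chainWitness θ P (σ P) k).1 (chainWitness θ P (σ P) k).2).1 s).R j X (Sect2.ofBackgroundC (settingOfRecord₁₃ F N θ.toStage13Params P).ι U)))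
    (hB : ∀ P : B12.RunParams, Step.InInterval γ P.K (gOfRecord₁₃ F N θ.toStage13Params P) →
      ∀ (k : ℕ) (s : SeqOfRecord F θ.ν θ.τ9.M (gOfRecord₁₃ F N θ.toStage13Params P) P.K (k + 1)) (S' : ℕ → Set (Site (F.P P.K) 0)) (j : ℕ)
        (X : (Sect2.domSys (F.P P.K) θ.τ9.M j).Dom),
      Continuous (fun q : GaugeField (F.P P.K) 0 (SU N) × MSFluct (F.P P.K) (FluctV N) =>
        ((σ P k (chainWitness θ P (σ P) k).1 (chainWitness θ P (σ P) k).2).1 s).B j X (Sect2.ofBackgroundC (settingOfRecord₁₃ F N θ.toStage13Params P).ι q.1) (S', q.2)))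
    (hCB : ∀ P : B12.RunParams, Step.InInterval γ P.K (gOfRecord₁₃ F N θ.toStage13Params P) →
      ∀ (k : ℕ) (s : SeqOfRecord F θ.ν θ.τ9.M (gOfRecord₁₃ F N θ.toStage13Params P) P.K (k + 1)) (j : ℕ), 1 ≤ j → ∃ CB : ℝ,
      ∀ (X : (Sect2.domSys (F.P P.K) θ.τ9.M j).Dom) (U : GaugeField (F.P P.K) 0 (SU N)) (a : Tk.SFluct (F.P P.K) (FluctV N)),
      |(((σ P k (chainWitness θ P (σ P) k).1 (chainWitness θ P (σ P) k).2).1 s).B j X (Sect2.ofBackgroundC (settingOfRecord₁₃ F N θ.toStage13Params P).ι U) a).re| ≤ CB)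
    (w : WorldP) (hC : w.C = (datumOfRecord₁₃CoPH F N θ h).C) (hγw : w.γ ≤ γ) : ∀ P : B12.RunParams, Dag.B14_main (leavesP w P) :=
  b14_main_leavesP_all_of_supplyChainAt_family θ h hsel hθ hκ hE₀ hB₀ hM
    (supplyChainAt_family_of_gaussCert_of_continuous θ hζ hq h hM σ hσ hE hCE hR hB hCB) w hC hγw

/-- **★★★ N11's PRINTED FACE `B16.Thm1Printed (datumOfRecord₁₃SepCoPH F N θ h).C` ON THE CONTINUITY ROAD** (the K1 items' key; any `0 < γ`), on the live-selector line, from — per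
windowed run — [III] §3's supplier with `SupplierObligations` and continuous bounded terms; the window printed is `]0, γ]`.  NO `cR`, NO K0 row, NO bg fact, NO run guard.
[cite: Balaban1988Convergent, Thm 1 p.262, Theorem p.245, p.244 L36–38, §3 p.279, (3.16) p.268, (3.23)–(3.25) p.270; Balaban1989LargeFieldII, Thm 1 p.355; Balaban1989LargeFieldI, (0.3)–(0.4) p.176, p.177 (i)–(ii)] -/
theorem thm1Printed_datumOfRecord₁₃SepCoPH_of_gaussCert_of_continuous
    (hζ : ∀ (p : B12.RunParams) (n : ℕ) (Ω Λ : ℕ → Set (Site (F.P p.K) 0)), (θ.Zh p n Ω Λ).ζ0 = (ZhPinOfRecord₁₃ θ.toStage13Params p Ω Λ).ζ0)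
    (hq : ∀ (p : B12.RunParams) (n : ℕ) (Ω Λ : ℕ → Set (Site (F.P p.K) 0)) (j : ℕ) (Λ' : Set (Site (F.P p.K) 0)) (ω : MultiCfg (F.P p.K) (SU N) (FluctV N)),
      (θ.Zh p n Ω Λ).quad j Λ' ω = ∑ b ∈ (Set.toFinite (bondsIn j (Λ'ᶜ ∩ Ω (j + 1)))).toFinset, ‖(ω j).2 b‖ ^ 2)
    (h : θ.Provisos₁₃SepCoPH F N) (hsel : θ.ppSel = ppSelLiveOfRecord F N θ.ν θ.τ9 (EOfRecord₁₃ F N θ.toStage13Params) (wOfRecord₉ F N θ.toStage9Params))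
    (hθ : θ.Admissible F N) (hκ : 0 ≤ θ.s2.lf.κ) (hE₀ : 0 ≤ θ.s2.lf.E₀) (hB₀ : 0 ≤ θ.s2.lf.B₀) (hM : 1 ≤ θ.τ9.M) {γ : ℝ} (hγ : 0 < γ)
    (σ : (P : B12.RunParams) → Sect3Supplier θ P)
    (hσ : ∀ P : B12.RunParams, Step.InInterval γ P.K (gOfRecord₁₃ F N θ.toStage13Params P) → SupplierObligations θ P (σ P))
    (hE : ∀ P : B12.RunParams, Step.InInterval γ P.K (gOfRecord₁₃ F N θ.toStage13Params P) →
      ∀ (k : ℕ) (s : SeqOfRecord F θ.ν θ.τ9.M (gOfRecord₁₃ F N θ.toStage13Params P) P.K (k + 1)) (j : ℕ), 1 ≤ j →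
      ∀ (X : (Sect2.domSys (F.P P.K) θ.τ9.M j).Dom) (z : Site (F.P P.K) j) (g' : ℝ),
      Continuous (fun U : GaugeField (F.P P.K) 0 (SU N) =>
        ((σ P k (chainWitness θ P (σ P) k).1 (chainWitness θ P (σ P) k).2).1 s).E j X z g' (Sect2.ofBackgroundC (settingOfRecord₁₃ F N θ.toStage13Params P).ι U)))
    (hCE : ∀ P : B12.RunParams, Step.InInterval γ P.K (gOfRecord₁₃ F N θ.toStage13Params P) →
      ∀ (k : ℕ) (s : SeqOfRecord F θ.ν θ.τ9.M (gOfRecord₁₃ F N θ.toStage13Params P) P.K (k + 1)) (j : ℕ), 1 ≤ j → ∃ CE : ℝ,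
      ∀ (X : (Sect2.domSys (F.P P.K) θ.τ9.M j).Dom) (z : Site (F.P P.K) j) (g' : ℝ) (U : GaugeField (F.P P.K) 0 (SU N)),
      |(((σ P k (chainWitness θ P (σ P) k).1 (chainWitness θ P (σ P) k).2).1 s).E j X z g' (Sect2.ofBackgroundC (settingOfRecord₁₃ F N θ.toStage13Params P).ι U)).re| ≤ CE)
    (hR : ∀ P : B12.RunParams, Step.InInterval γ P.K (gOfRecord₁₃ F N θ.toStage13Params P) →
      ∀ (k : ℕ) (s : SeqOfRecord F θ.ν θ.τ9.M (gOfRecord₁₃ F N θ.toStage13Params P) P.K (k + 1)) (j : ℕ), 1 ≤ j → ∀ X : (Sect2.domSys (F.P P.K) θ.τ9.M j).Dom,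
      Continuous (fun U : GaugeField (F.P P.K) 0 (SU N) =>
        ((σ P k (chainWitness θ P (σ P) k).1 (chainWitness θ P (σ P) k).2).1 s).R j X (Sect2.ofBackgroundC (settingOfRecord₁₃ F N θ.toStage13Params P).ι U)))
    (hB : ∀ P : B12.RunParams, Step.InInterval γ P.K (gOfRecord₁₃ F N θ.toStage13Params P) →
      ∀ (k : ℕ) (s : SeqOfRecord F θ.ν θ.τ9.M (gOfRecord₁₃ F N θ.toStage13Params P) P.K (k + 1)) (S' : ℕ → Set (Site (F.P P.K) 0)) (j : ℕ)
        (X : (Sect2.domSys (F.P P.K) θ.τ9.M j).Dom),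
      Continuous (fun q : GaugeField (F.P P.K) 0 (SU N) × MSFluct (F.P P.K) (FluctV N) =>
        ((σ P k (chainWitness θ P (σ P) k).1 (chainWitness θ P (σ P) k).2).1 s).B j X (Sect2.ofBackgroundC (settingOfRecord₁₃ F N θ.toStage13Params P).ι q.1) (S', q.2)))
    (hCB : ∀ P : B12.RunParams, Step.InInterval γ P.K (gOfRecord₁₃ F N θ.toStage13Params P) →
      ∀ (k : ℕ) (s : SeqOfRecord F θ.ν θ.τ9.M (gOfRecord₁₃ F N θ.toStage13Params P) P.K (k + 1)) (j : ℕ), 1 ≤ j → ∃ CB : ℝ,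
      ∀ (X : (Sect2.domSys (F.P P.K) θ.τ9.M j).Dom) (U : GaugeField (F.P P.K) 0 (SU N)) (a : Tk.SFluct (F.P P.K) (FluctV N)),
      |(((σ P k (chainWitness θ P (σ P) k).1 (chainWitness θ P (σ P) k).2).1 s).B j X (Sect2.ofBackgroundC (settingOfRecord₁₃ F N θ.toStage13Params P).ι U) a).re| ≤ CB) :
    B16.Thm1Printed (datumOfRecord₁₃SepCoPH F N θ h).C :=
  thm1Printed_datumOfRecord₁₃SepCoPH_of_supplyChainAt_family θ h hsel hθ hκ hE₀ hB₀ hM hγ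
    (supplyChainAt_family_of_gaussCert_of_continuous θ hζ hq h.toCore hM σ hσ hE hCE hR hB hCB)

/-- **★★★ THE `h11`-SHAPED (S1ᵀ) FAMILY OF THE K1⁹-BY-NAME ROAD ON THE CONTINUITY ROAD** (`γ₁₁ := γ`, any `0 < γ`; SepCoPH key): §1's socket over §3's token family.  NO `cR`, NO K0 row,
NO bg fact, NO run guard; `βup ∕ β₀ ∕ b7…b11 ∕ smallFieldInductive ∕ flowControl` UNREAD. [cite: Balaban1988Convergent, Theorem p.245, Thm 1 p.262, remark p.262, p.244 L36–38, §3 p.279, (3.23)–(3.25) p.270; Balaban1989LargeFieldII, Thm 1 + (0.1) pp.355–356; Balaban1989LargeFieldI, (0.3)–(0.4) p.176, p.177 (i)–(ii)] -/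
theorem h11Family_of_gaussCert_of_continuous
    (hζ : ∀ (p : B12.RunParams) (n : ℕ) (Ω Λ : ℕ → Set (Site (F.P p.K) 0)), (θ.Zh p n Ω Λ).ζ0 = (ZhPinOfRecord₁₃ θ.toStage13Params p Ω Λ).ζ0)
    (hq : ∀ (p : B12.RunParams) (n : ℕ) (Ω Λ : ℕ → Set (Site (F.P p.K) 0)) (j : ℕ) (Λ' : Set (Site (F.P p.K) 0)) (ω : MultiCfg (F.P p.K) (SU N) (FluctV N)),
      (θ.Zh p n Ω Λ).quad j Λ' ω = ∑ b ∈ (Set.toFinite (bondsIn j (Λ'ᶜ ∩ Ω (j + 1)))).toFinset, ‖(ω j).2 b‖ ^ 2)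
    (h : θ.Provisos₁₃SepCoPH F N) (hsel : θ.ppSel = ppSelLiveOfRecord F N θ.ν θ.τ9 (EOfRecord₁₃ F N θ.toStage13Params) (wOfRecord₉ F N θ.toStage9Params))
    (hθ : θ.Admissible F N) (hκ : 0 ≤ θ.s2.lf.κ) (hE₀ : 0 ≤ θ.s2.lf.E₀) (hB₀ : 0 ≤ θ.s2.lf.B₀) (hM : 1 ≤ θ.τ9.M) {γ : ℝ} (hγ : 0 < γ)
    (σ : (P : B12.RunParams) → Sect3Supplier θ P)
    (hσ : ∀ P : B12.RunParams, Step.InInterval γ P.K (gOfRecord₁₃ F N θ.toStage13Params P) → SupplierObligations θ P (σ P))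
    (hE : ∀ P : B12.RunParams, Step.InInterval γ P.K (gOfRecord₁₃ F N θ.toStage13Params P) →
      ∀ (k : ℕ) (s : SeqOfRecord F θ.ν θ.τ9.M (gOfRecord₁₃ F N θ.toStage13Params P) P.K (k + 1)) (j : ℕ), 1 ≤ j →
      ∀ (X : (Sect2.domSys (F.P P.K) θ.τ9.M j).Dom) (z : Site (F.P P.K) j) (g' : ℝ),
      Continuous (fun U : GaugeField (F.P P.K) 0 (SU N) =>
        ((σ P k (chainWitness θ P (σ P) k).1 (chainWitness θ P (σ P) k).2).1 s).E j X z g' (Sect2.ofBackgroundC (settingOfRecord₁₃ F N θ.toStage13Params P).ι U)))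
    (hCE : ∀ P : B12.RunParams, Step.InInterval γ P.K (gOfRecord₁₃ F N θ.toStage13Params P) →
      ∀ (k : ℕ) (s : SeqOfRecord F θ.ν θ.τ9.M (gOfRecord₁₃ F N θ.toStage13Params P) P.K (k + 1)) (j : ℕ), 1 ≤ j → ∃ CE : ℝ,
      ∀ (X : (Sect2.domSys (F.P P.K) θ.τ9.M j).Dom) (z : Site (F.P P.K) j) (g' : ℝ) (U : GaugeField (F.P P.K) 0 (SU N)),
      |(((σ P k (chainWitness θ P (σ P) k).1 (chainWitness θ P (σ P) k).2).1 s).E j X z g' (Sect2.ofBackgroundC (settingOfRecord₁₃ F N θ.toStage13Params P).ι U)).re| ≤ CE)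
    (hR : ∀ P : B12.RunParams, Step.InInterval γ P.K (gOfRecord₁₃ F N θ.toStage13Params P) →
      ∀ (k : ℕ) (s : SeqOfRecord F θ.ν θ.τ9.M (gOfRecord₁₃ F N θ.toStage13Params P) P.K (k + 1)) (j : ℕ), 1 ≤ j → ∀ X : (Sect2.domSys (F.P P.K) θ.τ9.M j).Dom,
      Continuous (fun U : GaugeField (F.P P.K) 0 (SU N) =>
        ((σ P k (chainWitness θ P (σ P) k).1 (chainWitness θ P (σ P) k).2).1 s).R j X (Sect2.ofBackgroundC (settingOfRecord₁₃ F N θ.toStage13Params P).ι U)))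
    (hB : ∀ P : B12.RunParams, Step.InInterval γ P.K (gOfRecord₁₃ F N θ.toStage13Params P) →
      ∀ (k : ℕ) (s : SeqOfRecord F θ.ν θ.τ9.M (gOfRecord₁₃ F N θ.toStage13Params P) P.K (k + 1)) (S' : ℕ → Set (Site (F.P P.K) 0)) (j : ℕ)
        (X : (Sect2.domSys (F.P P.K) θ.τ9.M j).Dom),
      Continuous (fun q : GaugeField (F.P P.K) 0 (SU N) × MSFluct (F.P P.K) (FluctV N) =>
        ((σ P k (chainWitness θ P (σ P) k).1 (chainWitness θ P (σ P) k).2).1 s).B j X (Sect2.ofBackgroundC (settingOfRecord₁₃ F N θ.toStage13Params P).ι q.1) (S', q.2)))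
    (hCB : ∀ P : B12.RunParams, Step.InInterval γ P.K (gOfRecord₁₃ F N θ.toStage13Params P) →
      ∀ (k : ℕ) (s : SeqOfRecord F θ.ν θ.τ9.M (gOfRecord₁₃ F N θ.toStage13Params P) P.K (k + 1)) (j : ℕ), 1 ≤ j → ∃ CB : ℝ,
      ∀ (X : (Sect2.domSys (F.P P.K) θ.τ9.M j).Dom) (U : GaugeField (F.P P.K) 0 (SU N)) (a : Tk.SFluct (F.P P.K) (FluctV N)),
      |(((σ P k (chainWitness θ P (σ P) k).1 (chainWitness θ P (σ P) k).2).1 s).B j X (Sect2.ofBackgroundC (settingOfRecord₁₃ F N θ.toStage13Params P).ι U) a).re| ≤ CB) :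
    ∀ βup β₀ : ℝ, ∃ γ₁₁ : ℝ, 0 < γ₁₁ ∧ ∀ w : WorldP, w.C = (datumOfRecord₁₃SepCoPH F N θ h).C → w.βup = βup → w.β₀ = β₀ → w.γ ≤ γ₁₁ →
      ∀ P : B12.RunParams, (leavesP w P).b7 → (leavesP w P).b8 → (leavesP w P).b9 → (leavesP w P).b10 → (leavesP w P).b11 →
      (leavesP w P).smallCouplings → (leavesP w P).smallFieldInductive → (leavesP w P).flowControl →
        ∀ k, k < P.K → SLaw₁₃CoPH F N θ P k → TLaw₁₃CoPH F N θ P k :=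
  h11Family_of_supplyChainAt_family θ h hsel hθ hκ hE₀ hB₀ hM hγ (supplyChainAt_family_of_gaussCert_of_continuous θ hζ hq h.toCore hM σ hσ hE hCE hR hB hCB)

end Continuous

end Summit.QuantumFields.YangMills.Theorems.BalabanUVNodesN11NodeFacesOfSupplyChainTokens

end
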